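import Literature.AnabelianGeometry.SemiGraphs.UniversalCoveringOverDevelop
import Mathlib.CategoryTheory.Core
import HarnessLib

/-!
# Developing a split covering along `𝒢_{∞,F}` ([SemiAnbd] Def. 3.5 (ii), §3 p. 38) — the morphism

Sequel to `UniversalCoveringOverDevelop.lean`.  The transports `Dev E ≃ Dev V` along the branches
of `𝔾_F` assemble, by the universal property of the free groupoid (Mathlib
`Quiver.FreeGroupoid.lift`), into a functor `Π(𝔾_F) ⥤ Core (Type u)` (`CovObj.devFunctor`); the
value of the transported base development at the point component gives the **developing map**
`CovObj.develop : 𝒢_{∞,F} ⟶ S` (`(V, x, q) ↦ (q · f₀)(x)`), a morphism of `B^cov(𝒢)` (equivariance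
= equivariance of developments, compatibility with the gluings = the transport formula at glued
points).  Main statement (`CovObj.exists_hom_univCoverOver_of_splitsAt`): if `F` splits `S` at
every point of the connected component of `s₀ ∈ S_{v₀}` (the hypothesis furnished by Def. 3.5 (ii)
for tempered `S`), then for every `x₀ ∈ F_{v₀}` there is a morphism `𝒢_{∞,F} ⟶ S` (base component
the orbit of `x₀`) taking the base point `([x₀], x₀, 𝟙)` to `s₀` — [SemiAnbd] p. 38: the tempered
coverings are dominated by the `𝒢_{∞,i} → 𝒢`.
-/

namespace Literature.AnabelianGeometry.SemiGraphs

namespace ProfiniteSemiGraph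

open CategoryTheory
open Literature.AlgebraicGeometry.Frobenioids.QuasiTemperoid.BTempConnected (ρ_one_apply
  ρ_mul_apply ρ_inv_apply)

universe u

variable {𝒢 : ProfiniteSemiGraph.{u}}

section Functor

variable (F S : CovObj 𝒢) (p₀ : S.Point) (hsplit : ∀ q, S.SameComponent p₀ q → F.SplitsAt S q)

/-- The edge-orbit of an arrow `E → V` of `Cat(𝔾_F)` lies over the edge of its branch.
[cite: MochizukiSemiAnbd2006, Def. 2.11 p.32] -/
theorem CovObj.catArrow_base {E : F.OEdge} {V : F.OVertex}
    (β : @SemiGraph.CatArrow F.orbitGraph (Sum.inr E) (Sum.inl V)) :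
    CovObj.OEdge.base F E = 𝒢.graph.edgeOf β.1.1.1 := by
  obtain ⟨⟨⟨b, E'⟩, h⟩, hE, hV⟩ := β
  cases hE
  exact h

/-- The branch of an arrow `E → V` of `Cat(𝔾_F)` abuts to `V`. [cite: MochizukiSemiAnbd2006, Def. 2.11 p.32] -/
theorem CovObj.catArrow_abuts {E : F.OEdge} {V : F.OVertex}
    (β : @SemiGraph.CatArrow F.orbitGraph (Sum.inr E) (Sum.inl V)) :
    F.orbitGraph.abuts ⟨(β.1.1.1, E), CovObj.catArrow_base F β⟩ = some V := by
  obtain ⟨⟨⟨b, E'⟩, h⟩, hE, hV⟩ := β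
  cases hE
  exact hV

/-- The development prefunctor on the generating quiver of `Cat(𝔾_F)`: components to their sets
of developments, a branch `b : E → V` to the transport bijection `Dev E ≃ Dev V`.
[cite: MochizukiSemiAnbd2006, Def 3.5(ii) p.37] -/
noncomputable def CovObj.devPrefunctor : F.orbitGraph.CatCarrier ⥤q Core (Type u) where
  obj a := ⟨F.Dev S p₀ a⟩
  map {a a'} β := match a, a', β with
    | Sum.inr E, Sum.inl V, β => CoreHom.mk (Equiv.toIso
        (CovObj.devEquiv β.1.1.1 E (CovObj.catArrow_base F β) V (CovObj.catArrow_abuts F β)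
          hsplit))
    | Sum.inl _, Sum.inl _, β => PEmpty.elim β
    | Sum.inl _, Sum.inr _, β => PEmpty.elim β
    | Sum.inr _, Sum.inr _, β => PEmpty.elim β

/-- **The development functor** `Π(𝔾_F) ⥤ Core (Type u)` (universal property of the free
groupoid). [cite: MochizukiSemiAnbd2006, Def 3.5(ii) p.37] -/
noncomputable def CovObj.devFunctor : F.orbitGraph.FundamentalGroupoid ⥤ Core (Type u) :=
  Quiver.FreeGroupoid.lift (F.devPrefunctor S p₀ hsplit)

/-- Transport of developments along a path class `q : c ⟶ a` of `Π(𝔾_F)`.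
[cite: MochizukiSemiAnbd2006, Def 3.5(ii) p.37] -/
noncomputable def CovObj.devTransport (c a : F.orbitGraph.CatCarrier)
    (q : F.orbitGraph.basept c ⟶ F.orbitGraph.basept a) (f : F.Dev S p₀ c) : F.Dev S p₀ a :=
  ((F.devFunctor S p₀ hsplit).map q).iso.hom f

/-- Transport along the identity. [cite: MochizukiSemiAnbd2006, Def 3.5(ii) p.37] -/
theorem CovObj.devTransport_id (c : F.orbitGraph.CatCarrier) (f : F.Dev S p₀ c) :
    F.devTransport S p₀ hsplit c c (𝟙 _) f = f := by
  change ((F.devFunctor S p₀ hsplit).map (𝟙 _)).iso.hom f = f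
  rw [CategoryTheory.Functor.map_id]
  rfl

/-- Transport along a composite. [cite: MochizukiSemiAnbd2006, Def 3.5(ii) p.37] -/
theorem CovObj.devTransport_comp (c a a' : F.orbitGraph.CatCarrier)
    (q : F.orbitGraph.basept c ⟶ F.orbitGraph.basept a)
    (r : F.orbitGraph.basept a ⟶ F.orbitGraph.basept a') (f : F.Dev S p₀ c) :
    F.devTransport S p₀ hsplit c a' (q ≫ r) f =
      F.devTransport S p₀ hsplit a a' r (F.devTransport S p₀ hsplit c a q f) := by
  change ((F.devFunctor S p₀ hsplit).map (q ≫ r)).iso.hom f = _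
  rw [CategoryTheory.Functor.map_comp]
  rfl

/-- Transport along the arrow of a branch `b : E → V` is the forward transport `devFwd`.
[cite: MochizukiSemiAnbd2006, Def 3.5(ii) p.37] -/
theorem CovObj.devTransport_brArrow {E : F.OEdge} {V : F.OVertex}
    (β : @SemiGraph.CatArrow F.orbitGraph (Sum.inr E) (Sum.inl V)) (f : F.DevE S p₀ E) :
    F.devTransport S p₀ hsplit (Sum.inr E) (Sum.inl V)
        ((Quiver.FreeGroupoid.of F.orbitGraph.CatCarrier).map β) f =
      CovObj.devFwd β.1.1.1 E (CovObj.catArrow_base F β) V (CovObj.catArrow_abuts F β) hsplit f := by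
  change ((Paths.lift (Quiver.Symmetrify.lift (F.devPrefunctor S p₀ hsplit))).map
    (@Quiver.Hom.toPath (Quiver.Symmetrify F.orbitGraph.CatCarrier) _ (Sum.inr E) (Sum.inl V)
      (Sum.inl β))).iso.hom f = _
  rw [Paths.lift_toPath]
  rfl

/-- Transport along the arrow `b̃ : E → glue_b E` of `Cat(𝔾_F)` attached to a branch `b : e → v` of
`𝔾`, evaluated at a glued point: `(b̃ · f)(glue_F y) = glue_S (f y)`.
[cite: MochizukiSemiAnbd2006, Def 3.5(ii) p.37] -/
theorem CovObj.devTransport_brArrowOver_apply_glue (b : 𝒢.graph.Branch) (v : 𝒢.graph.Vertex)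
    (h : 𝒢.graph.abuts b = some v) (E : {E : F.OEdge // CovObj.OEdge.base F E = 𝒢.graph.edgeOf b})
    (y : (F.SE (𝒢.graph.edgeOf b)).obj.V) (hy : (Quot.mk F.ERel ⟨𝒢.graph.edgeOf b, y⟩ : F.OEdge) = E.1)
    (f : F.DevE S p₀ E.1) :
    (F.devTransport S p₀ hsplit (Sum.inr E.1) (Sum.inl _) (F.brArrowOver b v h E y hy) f).1 v
        ((F.glue b v h).hom.hom.hom y) rfl =
      (S.glue b v h).hom.hom.hom (f.1 _ y hy) := by
  have hβ := F.devTransport_brArrow S p₀ hsplit (E := E.1)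
    (V := Quot.mk F.VRel ⟨v, (F.glue b v h).hom.hom.hom y⟩)
    ⟨⟨(b, E.1), E.2⟩, rfl, F.orbitGraph_abuts_mk b v h E y hy⟩ f
  exact (congrArg (fun d : F.DevV S p₀ _ => d.1 v ((F.glue b v h).hom.hom.hom y) rfl) hβ).trans
    (CovObj.devFwdFun_glue b E.1 E.2 (Quot.mk F.VRel ⟨v, (F.glue b v h).hom.hom.hom y⟩)
      (F.orbitGraph_abuts_mk b v h E y hy) hsplit f rfl y hy h rfl)

end Functor

/-! ### The developing map `𝒢_{∞,F} ⟶ S` -/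

section Develop

variable (F S : CovObj 𝒢) (p₀ : S.Point) (hsplit : ∀ q, S.SameComponent p₀ q → F.SplitsAt S q)
  (c : F.orbitGraph.CatCarrier) (f₀ : F.Dev S p₀ c) (h𝒢 : 𝒢.IsCountable)

/-- **The developing map** `𝒢_{∞,F} ⟶ S` determined by a base development `f₀ ∈ Dev c`:
`(V, x, q) ↦ (q · f₀)(x)`. [cite: MochizukiSemiAnbd2006, Prop 3.6 p.38] -/
noncomputable def CovObj.develop : F.univCoverOver c h𝒢 ⟶ S where
  fV v := ObjectProperty.homMk
    { hom := TypeCat.ofHom fun t : F.FibV c v =>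
        (F.devTransport S p₀ hsplit c (Sum.inl t.1.1) t.2.2 f₀).1 v t.2.1.1 t.2.1.2
      comm := fun g => by
        apply ConcreteCategory.hom_ext
        intro t
        exact (F.devTransport S p₀ hsplit c (Sum.inl t.1.1) t.2.2 f₀).2.1 v t.2.1.1 t.2.1.2 g _ }
  fE e := ObjectProperty.homMk
    { hom := TypeCat.ofHom fun t : F.FibE c e =>
        (F.devTransport S p₀ hsplit c (Sum.inr t.1.1) t.2.2 f₀).1 e t.2.1.1 t.2.1.2
      comm := fun g => by
        apply ConcreteCategory.hom_ext
        intro t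
        exact (F.devTransport S p₀ hsplit c (Sum.inr t.1.1) t.2.2 f₀).2.1 e t.2.1.1 t.2.1.2 g _ }
  comm b v h := by
    apply ObjectProperty.hom_ext
    apply Action.Hom.ext
    apply ConcreteCategory.hom_ext
    intro t
    change (S.glue b v h).hom.hom.hom
        ((F.devTransport S p₀ hsplit c (Sum.inr t.1.1) t.2.2 f₀).1 _ t.2.1.1 t.2.1.2) =
      (F.devTransport S p₀ hsplit c (Sum.inl _)
          (t.2.2 ≫ F.brArrowOver b v h t.1 t.2.1.1 t.2.1.2) f₀).1 v
        ((F.glue b v h).hom.hom.hom t.2.1.1) rfl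
    rw [CovObj.devTransport_comp]
    exact (F.devTransport_brArrowOver_apply_glue S p₀ hsplit b v h t.1 t.2.1.1 t.2.1.2 _).symm

/-- The developing map on a point of a vertex fibre. [cite: MochizukiSemiAnbd2006, Prop 3.6 p.38] -/
theorem CovObj.develop_fV_apply (v : 𝒢.graph.Vertex) (t : F.FibV c v) :
    ((F.develop S p₀ hsplit c f₀ h𝒢).fV v).hom.hom t =
      (F.devTransport S p₀ hsplit c (Sum.inl t.1.1) t.2.2 f₀).1 v t.2.1.1 t.2.1.2 := rfl

/-- The developing map on a point of an edge fibre. [cite: MochizukiSemiAnbd2006, Prop 3.6 p.38] -/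
theorem CovObj.develop_fE_apply (e : 𝒢.graph.Edge) (t : F.FibE c e) :
    ((F.develop S p₀ hsplit c f₀ h𝒢).fE e).hom.hom t =
      (F.devTransport S p₀ hsplit c (Sum.inr t.1.1) t.2.2 f₀).1 e t.2.1.1 t.2.1.2 := rfl

/-- The values of the developing map lie in the component of `p₀` (vertex fibres).
[cite: MochizukiSemiAnbd2006, Prop 3.6 p.38] -/
theorem CovObj.develop_fV_sameComponent (v : 𝒢.graph.Vertex) (t : F.FibV c v) :
    S.SameComponent p₀ (Sum.inl ⟨v, ((F.develop S p₀ hsplit c f₀ h𝒢).fV v).hom.hom t⟩) :=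
  (F.devTransport S p₀ hsplit c (Sum.inl t.1.1) t.2.2 f₀).2.2 v t.2.1.1 t.2.1.2

/-- The values of the developing map lie in the component of `p₀` (edge fibres).
[cite: MochizukiSemiAnbd2006, Prop 3.6 p.38] -/
theorem CovObj.develop_fE_sameComponent (e : 𝒢.graph.Edge) (t : F.FibE c e) :
    S.SameComponent p₀ (Sum.inr ⟨e, ((F.develop S p₀ hsplit c f₀ h𝒢).fE e).hom.hom t⟩) :=
  (F.devTransport S p₀ hsplit c (Sum.inr t.1.1) t.2.2 f₀).2.2 e t.2.1.1 t.2.1.2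

end Develop

/-! ### The base development through a pair of points and the domination statement -/

section Base

variable (F S : CovObj 𝒢) (v₀ : 𝒢.graph.Vertex) (x₀ : (F.SV v₀).obj.V) (s₀ : (S.SV v₀).obj.V)
  (hsplit : ∀ q, S.SameComponent (Sum.inl ⟨v₀, s₀⟩) q → F.SplitsAt S q)

/-- A *base witness* for a point `x` of the orbit of `x₀`: `x = g · x₀` (with `x₀`, `s₀` presented
over the vertex of `x`). [cite: MochizukiSemiAnbd2006, Def 3.5(ii) p.37] -/
structure CovObj.BaseWitness (w : 𝒢.graph.Vertex) (x : (F.SV w).obj.V) where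
  /-- `x₀` over `w` -/
  x' : (F.SV w).obj.V
  /-- `s₀` over `w` -/
  s' : (S.SV w).obj.V
  /-- the group element -/
  g : 𝒢.Gv w
  /-- `x'` is `x₀` -/
  hx' : (⟨w, x'⟩ : Σ v, (F.SV v).obj.V) = ⟨v₀, x₀⟩
  /-- `s'` is `s₀` -/
  hs' : (⟨w, s'⟩ : Σ v, (S.SV v).obj.V) = ⟨v₀, s₀⟩
  /-- `x = g · x₀` -/
  hx : x = (F.SV w).obj.ρ g x'

/-- Every point of the orbit of `x₀` has a base witness. [cite: MochizukiSemiAnbd2006, Def 3.5(ii) p.37] -/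
theorem CovObj.nonempty_baseWitness (w : 𝒢.graph.Vertex) (x : (F.SV w).obj.V)
    (h : (Quot.mk F.VRel ⟨w, x⟩ : F.OVertex) = Quot.mk F.VRel ⟨v₀, x₀⟩) :
    Nonempty (CovObj.BaseWitness F S v₀ x₀ s₀ w x) := by
  have hw : w = v₀ := congrArg (CovObj.OVertex.base F) h
  subst hw
  obtain ⟨g, hg⟩ := F.exists_ρ_of_mk_eq_mk h.symm
  exact ⟨⟨x₀, s₀, g, rfl, rfl, hg.symm⟩⟩

include hsplit in
/-- The value `g · s₀` does not depend on the base witness (splitting at `s₀`).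
[cite: MochizukiSemiAnbd2006, Def 3.5(ii) p.37] -/
theorem CovObj.devBase_wd {w : 𝒢.graph.Vertex} {x : (F.SV w).obj.V}
    (W W' : CovObj.BaseWitness F S v₀ x₀ s₀ w x) :
    (S.SV w).obj.ρ W.g W.s' = (S.SV w).obj.ρ W'.g W'.s' := by
  obtain ⟨x', s', g, hx', hs', hx⟩ := W
  obtain ⟨x'', s'', g', hx'', hs'', hx2⟩ := W'
  cases hx'
  cases hs'
  obtain ⟨_, hxx⟩ := Sigma.mk.inj_iff.mp hx''
  obtain ⟨_, hss⟩ := Sigma.mk.inj_iff.mp hs''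
  cases eq_of_heq hxx
  cases eq_of_heq hss
  change (S.SV v₀).obj.ρ g s₀ = (S.SV v₀).obj.ρ g' s₀
  have hfix : (F.SV v₀).obj.ρ (g⁻¹ * g') x₀ = x₀ := by
    rw [ρ_mul_apply, ← hx2, hx, ρ_inv_apply]
  have hst : (S.SV v₀).obj.ρ (g⁻¹ * g') s₀ = s₀ :=
    hsplit _ (Relation.EqvGen.refl _) x₀ _ hfix
  conv_lhs => rw [← hst, ← ρ_mul_apply, ← mul_assoc, mul_inv_cancel, one_mul]

/-- The base development as a bare function: `g · x₀ ↦ g · s₀`.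
[cite: MochizukiSemiAnbd2006, Def 3.5(ii) p.37] -/
noncomputable def CovObj.devBaseFun (w : 𝒢.graph.Vertex) (x : (F.SV w).obj.V)
    (h : (Quot.mk F.VRel ⟨w, x⟩ : F.OVertex) = Quot.mk F.VRel ⟨v₀, x₀⟩) : (S.SV w).obj.V :=
  let W := Classical.choice (CovObj.nonempty_baseWitness F S v₀ x₀ s₀ w x h)
  (S.SV w).obj.ρ W.g W.s'

include hsplit in
/-- The base development evaluated through any base witness. [cite: MochizukiSemiAnbd2006, Def 3.5(ii) p.37] -/
theorem CovObj.devBaseFun_eq {w : 𝒢.graph.Vertex} {x : (F.SV w).obj.V}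
    (h : (Quot.mk F.VRel ⟨w, x⟩ : F.OVertex) = Quot.mk F.VRel ⟨v₀, x₀⟩)
    (W : CovObj.BaseWitness F S v₀ x₀ s₀ w x) :
    CovObj.devBaseFun F S v₀ x₀ s₀ w x h = (S.SV w).obj.ρ W.g W.s' :=
  CovObj.devBase_wd F S v₀ x₀ s₀ hsplit _ W

/-- **The base development** through `(x₀, s₀)`: the equivariant map `[x₀] → S_{v₀}`,
`g · x₀ ↦ g · s₀` (well defined since `F` splits `S` at `s₀`), an element of `Dev [x₀]`.
[cite: MochizukiSemiAnbd2006, Def 3.5(ii) p.37] -/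
noncomputable def CovObj.devBase :
    F.Dev S (Sum.inl ⟨v₀, s₀⟩) (Sum.inl (Quot.mk F.VRel ⟨v₀, x₀⟩)) :=
  ⟨CovObj.devBaseFun F S v₀ x₀ s₀, by
    refine ⟨fun w x h g h' => ?_, fun w x h => ?_⟩
    · obtain ⟨W⟩ := CovObj.nonempty_baseWitness F S v₀ x₀ s₀ w x h
      rw [CovObj.devBaseFun_eq F S v₀ x₀ s₀ hsplit h W,
        CovObj.devBaseFun_eq F S v₀ x₀ s₀ hsplit h'
          ⟨W.x', W.s', g * W.g, W.hx', W.hs', by rw [ρ_mul_apply, ← W.hx]⟩, ρ_mul_apply]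
    · obtain ⟨W⟩ := CovObj.nonempty_baseWitness F S v₀ x₀ s₀ w x h
      rw [CovObj.devBaseFun_eq F S v₀ x₀ s₀ hsplit h W]
      obtain ⟨x', s', g, hx', hs', hx⟩ := W
      cases hs'
      exact Relation.EqvGen.rel _ _ (CovObj.Adj.vertex v₀ g s₀)⟩

/-- The base development takes `x₀` to `s₀`. [cite: MochizukiSemiAnbd2006, Def 3.5(ii) p.37] -/
theorem CovObj.devBase_apply_base :
    (CovObj.devBase F S v₀ x₀ s₀ hsplit).1 v₀ x₀ rfl = s₀ := by
  change CovObj.devBaseFun F S v₀ x₀ s₀ v₀ x₀ rfl = s₀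
  rw [CovObj.devBaseFun_eq F S v₀ x₀ s₀ hsplit rfl ⟨x₀, s₀, 1, rfl, rfl, (ρ_one_apply _ _).symm⟩]
  exact ρ_one_apply _ _

/-- **Domination of split components by `𝒢_{∞,F}`** ([SemiAnbd] Def. 3.5 (ii) ⇒ p. 38).  Let `S`
be a covering of `𝒢` (object of `B^cov(𝒢)`, `𝒢` countable), `s₀ ∈ S_{v₀}`, and `F` a covering
which *splits* `S` at every point of the connected component of `s₀` (for tempered `S` and finite
étale `F` this is Def. 3.5 (ii)).  Then for every `x₀ ∈ F_{v₀}` there is a morphism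
`𝒢_{∞,F} ⟶ S` from the covering `𝒢_{∞,F} → 𝒢` attached to `F` and the base vertex `[x₀]` of
`𝔾_F` ("the covering of `𝒢_F` determined by the universal graph-covering of `𝔾_F`", p. 38) which
takes the base point `([x₀], x₀, 𝟙)` to `s₀`: the component of `s₀` is dominated by `𝒢_{∞,F}`.
[cite: MochizukiSemiAnbd2006, Prop 3.6 p.38] -/
theorem CovObj.exists_hom_univCoverOver_of_splitsAt (h𝒢 : 𝒢.IsCountable) (F S : CovObj 𝒢)
    (v₀ : 𝒢.graph.Vertex) (x₀ : (F.SV v₀).obj.V) (s₀ : (S.SV v₀).obj.V)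
    (hsplit : ∀ q, S.SameComponent (Sum.inl ⟨v₀, s₀⟩) q → F.SplitsAt S q) :
    ∃ φ : F.univCoverOver (Sum.inl (Quot.mk F.VRel ⟨v₀, x₀⟩)) h𝒢 ⟶ S,
      (φ.fV v₀).hom.hom ⟨⟨Quot.mk F.VRel ⟨v₀, x₀⟩, rfl⟩, ⟨⟨x₀, rfl⟩, 𝟙 _⟩⟩ = s₀ := by
  refine ⟨F.develop S _ hsplit _ (CovObj.devBase F S v₀ x₀ s₀ hsplit) h𝒢, ?_⟩
  rw [CovObj.develop_fV_apply]
  change (F.devTransport S _ hsplit _ _ (𝟙 _) (CovObj.devBase F S v₀ x₀ s₀ hsplit)).1 v₀ x₀ rfl = s₀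
  rw [CovObj.devTransport_id]
  exact CovObj.devBase_apply_base F S v₀ x₀ s₀ hsplit

/-- The same, recording moreover that the whole image of the developing map lies in the connected
component of `s₀`. [cite: MochizukiSemiAnbd2006, Prop 3.6 p.38] -/
theorem CovObj.exists_hom_univCoverOver_of_splitsAt' (h𝒢 : 𝒢.IsCountable) (F S : CovObj 𝒢)
    (v₀ : 𝒢.graph.Vertex) (x₀ : (F.SV v₀).obj.V) (s₀ : (S.SV v₀).obj.V)
    (hsplit : ∀ q, S.SameComponent (Sum.inl ⟨v₀, s₀⟩) q → F.SplitsAt S q) :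
    ∃ φ : F.univCoverOver (Sum.inl (Quot.mk F.VRel ⟨v₀, x₀⟩)) h𝒢 ⟶ S,
      (φ.fV v₀).hom.hom ⟨⟨Quot.mk F.VRel ⟨v₀, x₀⟩, rfl⟩, ⟨⟨x₀, rfl⟩, 𝟙 _⟩⟩ = s₀ ∧
      (∀ v t, S.SameComponent (Sum.inl ⟨v₀, s₀⟩) (Sum.inl ⟨v, (φ.fV v).hom.hom t⟩)) ∧
      ∀ e t, S.SameComponent (Sum.inl ⟨v₀, s₀⟩) (Sum.inr ⟨e, (φ.fE e).hom.hom t⟩) := by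
  refine ⟨F.develop S _ hsplit _ (CovObj.devBase F S v₀ x₀ s₀ hsplit) h𝒢, ?_,
    F.develop_fV_sameComponent S _ hsplit _ _ h𝒢, F.develop_fE_sameComponent S _ hsplit _ _ h𝒢⟩
  rw [CovObj.develop_fV_apply]
  change (F.devTransport S _ hsplit _ _ (𝟙 _) (CovObj.devBase F S v₀ x₀ s₀ hsplit)).1 v₀ x₀ rfl = s₀
  rw [CovObj.devTransport_id]
  exact CovObj.devBase_apply_base F S v₀ x₀ s₀ hsplit

end Base

end ProfiniteSemiGraph

end Literature.AnabelianGeometry.SemiGraphs
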